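import Literature.AnabelianGeometry.AbsoluteAnabelian.AbsTopIII.BirationalReconstruction
import Literature.AnabelianGeometry.AbsoluteAnabelian.AbsTopIThm26vProofs
import Literature.AnabelianGeometry.AbsoluteAnabelian.AbsTopIThm26vFullTransportProofs
import Literature.AnabelianGeometry.AbsoluteAnabelian.AbsTopII.Remark332Proofs
import HarnessLib

/-!
# [AbsTopIII] Rmk. 1.11.1 (i) (`Rmk_1_11_1_i`, FACT-LIST F-0335): conditional closers BY NAME —
# the birational `ζ`-characterisation of `Δ_{η_X}` ([AbsTopII] Cor. 2.10, proof ¶1) suffices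

S. Mochizuki, *Topics in Absolute Anabelian Geometry III: global reconstruction algorithms*
[MochizukiAbsTopIII2015], §1, Rmk. 1.11.1 (i), author's manuscript p. 47 (`paper:url-5493eb38cbb7`):
"One verifies immediately that when `k` is an MLF, the semi-absolute algorithms of Theorem 1.11 may
be rendered absolute [i.e., one may construct the kernel of the quotient `Π_{η_X} ↠ G_k`] by applying
the algorithm that is implicit in the proof of the corresponding portion of [Mzk21], Corollary 2.10."
Here [Mzk21] = *Topics in Absolute Anabelian Geometry II* [MochizukiAbsTopII2013], Cor. 2.10
("Geometricity of Absolute Isomorphisms for Co-Galois-dense Pro-curves", manuscript pp. 61–62;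
`Spec` of the function field of a curve over an MLF is a co-Galois-dense pro-curve, Rmk. 2.8.1 p. 55),
whose proof, first paragraph, reads: "in the notation of [Mzk15] (= [AbsTopI]), Theorem 2.6,
`sup_{p′, p″ ∈ Σ} {δ¹_{p′}(Π_{Uᵢ}) − δ¹_{p″}(Π_{Uᵢ})} = … = [kᵢ : ℚ_{pᵢ}]` — cf. [Mzk15], Theorem 2.6,
(ii). In particular, by applying this chain of equalities to arbitrary open subgroups of `Π_{Uᵢ}`, we
conclude that `α` induces an isomorphism `α_G : G₁ ⥲ G₂`."

PROOF-ONLY file (abc-iut cell, L-F row F-0335 keyed by the hub 2026-08-27T03:44Z; seat abc-iut-L3-t8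
gen 7; no definition, no instance, no new `Prop` fact; `BirationalReconstruction.lean` imported, never
edited).  The trunk types Rmk. 1.11.1 (i) as the closed fact `AbsTopIII.Rmk_1_11_1_i` ("for function
fields of genus `≥ 2` over MLF's, every bicontinuous `Gal(K̄/K) ≅ Gal(K̄'/K')` carries `Δ_{η_X}` onto
`Δ_{η_{X'}}`"; abc-iut-L4-t1).  This file lands theorems CONCLUDING IN THAT DECL BY NAME, reducing it
— exactly along the printed justification — to the birational form of the `ζ`-characterisation of
[AbsTopI] Thm. 2.6 (v) at the extensions `1 → Δ_{η_X} → Gal(K̄/K) → Gal(k̄/k) → 1`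
(`genericPointExtension`), in four currencies already present in the tree:

* `Rmk_1_11_1_i_of_zeta_characterization` — from "`Δ_{η_X}` is the intersection of the open
  subgroups `H ⊆ Π_{η_X}` with `ζ(H)/ζ(Π_{η_X}) = [Π_{η_X} : H]`" at every such extension over an
  MLF (genus `≥ 2`), by abc-iut-L4-t6's transport lemma `geom_map_eq_of_zeta_characterization`
  ([AbsTopII] Rmk. 3.3.2 file);
* `Rmk_1_11_1_i_of_thm26v` / `Rmk_1_11_1_i_of_thm26vFull` — from the typed [AbsTopI] Thm. 2.6 (v)
  (`Thm26v`, case `Θ = {1}`; resp. the general-`Θ` form `Thm26vFull`) holding at these extensions for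
  SOME MLF base data (`preservesGeom_of_thm26v`, abc-iut-L4-t6; `preservesGeom_of_thm26vFull`,
  abc-iut-w6-d027);
* `Rmk_1_11_1_i_of_lemma114Display` — from the DISPLAY of [AbsAnab] Lemma 1.1.4 (ii) = the rank part
  of [AbsTopI] Thm. 2.6 (ii) "applied to arbitrary open subgroups" (the words of the proof of
  [AbsTopII] Cor. 2.10): for every open `Π′ ⊆ Gal(K̄/K)` with image `G′ ⊆ Gal(k̄/k)` and every prime
  `l ≠ p`, "`[G : G′]·[k : ℚ_p] = δ¹_p(Π′) − δ¹_l(Π′)`", via abc-iut-L4's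
  `thm26v_of_lemma114Display` (which supplies the `ζ`-characterisation from the display for EVERY
  abstract extension with MLF base data).

HONEST LABEL: CONDITIONAL closers.  The residual hypothesis in each is displayed, not smuggled: it is
the arithmetic content of the first paragraph of the proof of [AbsTopII] Cor. 2.10 for absolute Galois
groups of function fields over MLF's (torsion-free abelianisations `Π^{ab-t}_U ⥲ Π^{ab-t}_X`, local class
field theory, Poincaré duality), which is NOT proved here and is not a theorem of the tree (the tree's
discharges of `Thm26v` — `thm26v_of_coinvariantRankConstant`, `thm26v_of_starCondition` — require `Δ`
topologically finitely generated, which `Δ_{η_X}`, a free profinite group of infinite rank, is not).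
Refereed pre-IUT anabelian geometry, OUTSIDE the [IUTchIII] Cor. 3.12 cone; nothing here bears on
the disputed Cor. 3.12; no side taken; typed ≠ proved.
-/

noncomputable section

open scoped Classical

namespace Literature.AnabelianGeometry.AbsoluteAnabelian.AbsTopIII

open Literature.NumberTheory.GaloisRepresentations (absGaloisRestrict)
open Literature.NumberTheory.DiophantineGeometry
open Literature.NumberTheory.DiophantineGeometry.AlgFunctionField

universe u

/-! ### From the `ζ`-characterisation of `Δ_{η_X}` ([AbsTopI] Thm. 2.6 (v) shape) -/

/-- **Rmk. 1.11.1 (i) ⟸ the `ζ`-characterisation of `Δ_{η_X}`** ("the algorithm implicit in the proof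
of [AbsTopII] Cor. 2.10": `sup_{p′,p″} {δ¹_{p′} − δ¹_{p″}}` applied to arbitrary open subgroups).  IF
for every algebraic function field `K/k` of one variable of genus `≥ 2` over an MLF `k` algebraically
closed in `K` (with `Gal(K̄/K) ↠ Gal(k̄/k)`), the kernel `Δ_{η_X}` is the intersection of the open
subgroups `H ⊆ Gal(K̄/K)` with `ζ(H) = [Gal(K̄/K) : H]·ζ(Gal(K̄/K))`, THEN every bicontinuous
isomorphism `Gal(K̄/K) ≅ Gal(K̄'/K')` between two such carries `Δ_{η_X}` onto `Δ_{η_{X'}}` — the typed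
`Rmk_1_11_1_i`.  (Transport of the `ζ`-intersection: abc-iut-L4-t6's
`geom_map_eq_of_zeta_characterization`.) [cite: MochizukiAbsTopIII2015, Rmk 1.11.1 (i) p.47]
[cite: MochizukiAbsTopII2013, Cor 2.10 pp.61-62] -/
theorem Rmk_1_11_1_i_of_zeta_characterization
    (hζ : ∀ (k K : Type u) [Field k] [CharZero k] [Field K] [CharZero K] [Algebra k K]
      [IsAlgFunctionField k K] [IsIntegrallyClosedIn k K]
      (hsurj : Function.Surjective (absGaloisRestrict k K)),
      IsMLF k → 2 ≤ genus k K →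
        (genericPointExtension k K hsurj).geom =
          ⨅ (H : Subgroup (genericPointExtension k K hsurj).arith)
            (_ : IsOpen (H : Set (genericPointExtension k K hsurj).arith))
            (_ : zetaInv H = (H.index : ℕ∞) * zetaInv (genericPointExtension k K hsurj).arith), H) :
    Rmk_1_11_1_i.{u} := by
  intro k K _ _ _ _ _ _ _ hsurj k' K' _ _ _ _ _ _ _ hsurj' hk hk' hg hg' e
  exact FundamentalExtension.geom_map_eq_of_zeta_characterization
    (E := genericPointExtension k K hsurj) (F := genericPointExtension k' K' hsurj')
    (hζ k K hsurj hk hg) (hζ k' K' hsurj' hk' hg') e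

/-! ### From the typed [AbsTopI] Thm. 2.6 (v) at the generic-point extensions -/

/-- **Rmk. 1.11.1 (i) ⟸ [AbsTopI] Thm. 2.6 (v) (typed case `Θ = {1}`, `Thm26v`) at the generic-point
extensions over MLF's**: IF for every function field `K/k` of genus `≥ 2` over an MLF `k` (algebraically
closed in `K`) the extension `1 → Δ_{η_X} → Gal(K̄/K) → Gal(k̄/k) → 1` satisfies `Thm26v` for SOME MLF
base data ("`ζ(Π) = [k : ℚ_p]` and `Δ = ⋂ {H open | ζ(H)/ζ(Π) = [Π : H]}`"), THEN `Rmk_1_11_1_i`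
(abc-iut-L4-t6's `preservesGeom_of_thm26v`). [cite: MochizukiAbsTopIII2015, Rmk 1.11.1 (i) p.47]
[cite: MochizukiAbsTopI2012, Thm 2.6 (v) p.22] -/
theorem Rmk_1_11_1_i_of_thm26v
    (h : ∀ (k K : Type u) [Field k] [CharZero k] [Field K] [CharZero K] [Algebra k K]
      [IsAlgFunctionField k K] [IsIntegrallyClosedIn k K]
      (hsurj : Function.Surjective (absGaloisRestrict k K)),
      IsMLF k → 2 ≤ genus k K →
        ∃ B : (genericPointExtension k K hsurj).MLFBase, (genericPointExtension k K hsurj).Thm26v B) :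
    Rmk_1_11_1_i.{u} := by
  intro k K _ _ _ _ _ _ _ hsurj k' K' _ _ _ _ _ _ _ hsurj' hk hk' hg hg' e
  obtain ⟨BE, hE⟩ := h k K hsurj hk hg
  obtain ⟨BF, hF⟩ := h k' K' hsurj' hk' hg'
  exact FundamentalExtension.preservesGeom_of_thm26v
    (E := genericPointExtension k K hsurj) (F := genericPointExtension k' K' hsurj') hE hF e

/-- **Rmk. 1.11.1 (i) ⟸ [AbsTopI] Thm. 2.6 (v), general-`Θ` form (`Thm26vFull`), at the generic-point
extensions over MLF's** ("`ζ̃(Π) := ζ(Π/Θ) = [k : ℚ_p]`; the kernel of `Π ↠ G` is the intersection of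
the open `H` with `ζ̃(H)/ζ̃(Π) = [Π : H]`"): IF that holds for SOME MLF base data at every function field
of genus `≥ 2` over an MLF, THEN `Rmk_1_11_1_i` (abc-iut-w6-d027's `preservesGeom_of_thm26vFull`).
[cite: MochizukiAbsTopIII2015, Rmk 1.11.1 (i) p.47] [cite: MochizukiAbsTopI2012, Thm 2.6 (v) p.22] -/
theorem Rmk_1_11_1_i_of_thm26vFull
    (h : ∀ (k K : Type u) [Field k] [CharZero k] [Field K] [CharZero K] [Algebra k K]
      [IsAlgFunctionField k K] [IsIntegrallyClosedIn k K]
      (hsurj : Function.Surjective (absGaloisRestrict k K)),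
      IsMLF k → 2 ≤ genus k K →
        ∃ B : (genericPointExtension k K hsurj).MLFBase,
          (genericPointExtension k K hsurj).Thm26vFull B) :
    Rmk_1_11_1_i.{u} := by
  intro k K _ _ _ _ _ _ _ hsurj k' K' _ _ _ _ _ _ _ hsurj' hk hk' hg hg' e
  obtain ⟨BE, hE⟩ := h k K hsurj hk hg
  obtain ⟨BF, hF⟩ := h k' K' hsurj' hk' hg'
  exact FundamentalExtension.preservesGeom_of_thm26vFull
    (E := genericPointExtension k K hsurj) (F := genericPointExtension k' K' hsurj') hE hF e

/-! ### From the display of [AbsAnab] Lemma 1.1.4 (ii) for `Gal(K̄/K)` ("[AbsTopI] Thm. 2.6 (ii)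
applied to arbitrary open subgroups", [AbsTopII] Cor. 2.10 proof ¶1) -/

/-- **Rmk. 1.11.1 (i) ⟸ the display of [AbsAnab] Lemma 1.1.4 (ii) for absolute Galois groups of
function fields over MLF's** — the "chain of equalities" `sup_{p′,p″}{δ¹_{p′}(Π′) − δ¹_{p″}(Π′)} =
[k′ : ℚ_p]` of the proof of [AbsTopII] Cor. 2.10 "applied to arbitrary open subgroups", in the display
currency of abc-iut-L4's `thm26v_of_lemma114Display`: IF for every function field `K/k` of one variable
of genus `≥ 2` over a finite extension `k` of `ℚ_p` algebraically closed in `K`, every open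
`Π′ ⊆ Gal(K̄/K)` with image `G′ ⊆ Gal(k̄/k)` and every prime `l ≠ p` satisfy
"`[G : G′]·[k : ℚ_p] = δ¹_p(Π′) − δ¹_l(Π′)`" (`δ¹_l = freeProlRank`), THEN `Rmk_1_11_1_i`.  The display
gives `Thm26v` at each generic-point extension (`thm26v_of_lemma114Display`, for EVERY abstract extension
with MLF base data), whence the `ζ`-characterisation and its transport.  Residual = the display, i.e.
`Gal(K̄/K)^{ab-t} ⥲ Π_X^{ab-t}` + local class field theory + duality, NOT proved here.
[cite: MochizukiAbsTopIII2015, Rmk 1.11.1 (i) p.47] [cite: MochizukiAbsTopII2013, Cor 2.10 pp.61-62]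
[cite: MochizukiAbsAnab2004, Lemma 1.1.4 (ii) p.7] -/
theorem Rmk_1_11_1_i_of_lemma114Display
    (hD : ∀ (k K : Type u) [Field k] [CharZero k] [Field K] [CharZero K] [Algebra k K]
      [IsAlgFunctionField k K] [IsIntegrallyClosedIn k K]
      (hsurj : Function.Surjective (absGaloisRestrict k K))
      (p : ℕ) [Fact p.Prime] [Algebra ℚ_[p] k] [FiniteDimensional ℚ_[p] k], 2 ≤ genus k K →
        ∀ (P : Subgroup (genericPointExtension k K hsurj).arith),
          IsOpen (P : Set (genericPointExtension k K hsurj).arith) → ∀ (l : ℕ) [Fact l.Prime], l ≠ p →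
          (((P.map (genericPointExtension k K hsurj).aug.toMonoidHom).index *
              Module.finrank ℚ_[p] k : ℕ) : ℕ∞) =
            freeProlRank P p - freeProlRank P l) :
    Rmk_1_11_1_i.{u} := by
  refine Rmk_1_11_1_i_of_thm26v fun k K _ _ _ _ _ _ _ hsurj hk hg => ?_
  -- MLF structure on `k`: a prime `p` and a finite `ℚ_p`-algebra structure
  obtain ⟨p, hp, f, hfin⟩ := hk.exists_padic
  letI : Fact p.Prime := hp
  letI : Algebra ℚ_[p] k := f.toAlgebra
  haveI : FiniteDimensional ℚ_[p] k := hfin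
  -- base data: `k` itself, identity on `Gal(k̄/k)`
  let B : (genericPointExtension k K hsurj).MLFBase :=
    { p := p, K := k, galIso := ContinuousMulEquiv.refl _ }
  refine ⟨B, FundamentalExtension.thm26v_of_lemma114Display (genericPointExtension k K hsurj) B ?_⟩
  intro P hP l hl hlp
  exact hD k K hsurj p hg P hP l hlp

end Literature.AnabelianGeometry.AbsoluteAnabelian.AbsTopIII

end
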